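import Summits.QuantumFields.BalabanUV.T4Continuum.Support.AbelianBlockAverage
import Summits.QuantumFields.BalabanUV.T4Continuum.Support.NE7BlockAverageContourGaugeZd

/-!
# NE7BlockAverageContourGaugeAbelian — H-1″ made NON-LINEAR in the abelian case: Bałaban's full average (42) of an abelian
# configuration `V = exp ∘ A` IS the exponential of the straight-stencil average, gauge-transformed on the coarse lattice by
# `exp` of the tree potential; its coarse plaquette variables are EXACTLY `exp` of the block means of the `L × L` Wilson loop
# sums — (47)–(50) p. 25 with NO error term when the group is commutative

Cell `pub-balaban`, rung (B)+1 sub-cell t4, lineage `b2b-balaban-t4-ne7-p2` (CRUX PROVER NE7 #2, coordinator ruling «YM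
redirect», 2026-08-21; generation 51; texts `HOME/t4/b2b-balaban-t4-ne7-p2/g51/HOM-JUNCTION-NE7-P2.md` v3 §2″).  GLUE over two
kernel files: `AbelianBlockAverage.bavg_expUnit` (NE3 formalisation leaf 03: in a commutative complete normed `ℂ`-algebra and
inside the ball of the logarithm, `V̄_c = exp (Tside L A c)` for `V = exp ∘ A`) and this lineage's
`NE7BlockAverageContourGaugeZd` (`Tside = Qstraight + treePot(c₋) − treePot(c₊)`, `cplaqLin (Tside A) = block mean of the
`L × L` loop sums`).

HONEST FRAMING (T4-DAG PAGE 1).  The cell's T⁴ target is the finite-torus continuum limit of Bałaban's unit-scale averaged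
loop expectations — NOT infinite volume, NO mass gap, NOT the Clay problem, NOT summit progress.  ABELIAN SANITY CASE ONLY
(commutative coefficient algebra): nothing is claimed for `SU(N)`, nothing of NE7 (NOT printed, NOT proved; spine 0∕9).  The
smallness hypothesis (`‖A(Γ_{c,x} ∪ −Γ_c)‖ < log 2` on the loops of (42)) is the tree's condition for `log ∘ exp = id`
(`B7BlockAvgLog.mlog_exp`); it is CARRIED, not discharged.
HONEST DEPENDENCY (cell, verbatim): continuum YM on T⁴ ⇐ BetaPertH ∧ nine spine estimates (0/9 proved); BetaPertH ⇐ (D1) ∧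
(D4) ∧ CAP+tail; G-an2-4 gates asym, D1 and NE2/3/4.

CITATION HEADER (lean-in-tree rule 2026-08-18).  No sentence of any paper is a hypothesis; `[cite:]` tags locate OBJECTS.
T. Bałaban, *Averaging operations for lattice gauge theories*, Commun. Math. Phys. **98** (1985) 17–51 [Balaban1985Averaging]
(«B7»): (42) p. 23 the average `V̄_c = exp[Σ_{x∈B(c₋)} L^{−d} log V(Γ_{c,x})V(c)⁻¹]·V(c)` (tree `B7Prop1Explicit.bavg`), (44)
p. 24 the `L`-plaquette variable `V̄(∂p′)` (tree `cplaq`), (45) p. 24 gauge covariance, (47)–(50) p. 25 «`|V̄₀(∂p′) − 1 −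
i Σ_{c⊂∂p′} Σ_{x∈B(c₋)} L^{−d} A(Γ_{c,x})| < O(1)(L²α₀)²`», «`Σ_{c⊂∂p′} Σ_{x∈B(c₋)} L^{−d} A(Γ_{c,x}) = Σ_{x∈B(y₀)} L^{−d}
A(∂(p′)_x) = Σ_{x∈B(y₀)} L^{−d} Σ_{p⊂(p′)_x} A(∂p)`» (quoted in full in the header of `B7Prop1Explicit`).
[cite: Balaban1985Averaging, (42) p. 23, (44)–(45) p. 24, (47)–(50) p. 25 (objects only)]

WHAT IS PROVED (all [folklore], 0 sorry; `𝔸` commutative complete normed `ℂ`-algebra, `V = exp ∘ A : ℤ^d-bonds → 𝔸ˣ`,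
`1 ≤ L`, smallness `hsmall` on the loops of (42)).
* `expUnit_add`, `expUnit_neg`, `expUnit_sub` — `exp` as a homomorphism into the units (commutative case).
* **`bavg_expUnit_eq_gauge`**: `V̄_c = exp(Φ(c₋)) · exp(Qstraight L A c) · exp(Φ(c₊))⁻¹`, `Φ = treePot L A` — THE FULL
  NON-LINEAR AVERAGE (42) OF AN ABELIAN CONFIGURATION IS THE STRAIGHT-STENCIL AVERAGE, GAUGE-TRANSFORMED ON THE `L`-LATTICE
  by `u = exp ∘ Φ` (B7's convention (8) `U^u(x,x′) = u(x)U(x,x′)u(x′)⁻¹`).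
* **`cplaq_bavg_expUnit`**: `V̄(∂p′) = exp(cplaqLin L (Tside L A) p′)` and **`cplaq_bavg_expUnit_eq_blockMean`**:
  `V̄(∂p′) = exp(Σ_{x∈B(y₀)} L^{−d} A(∂(p′)_x))` `= exp(Σ_{x∈B(y₀)} L^{−d} Σ_{p⊂(p′)_x} A(∂p))` (`…_eq_stokes`) — (47)–(50)
  EXACTLY: the coarse plaquette variable of the averaged abelian field is the geometric block mean of the products of the
  `L²` fine plaquette variables `V(∂p) = exp(A(∂p))` (`hol_expUnit_plaqWord`); in particular it does not see the tree
  contours at all, and `V̄ ≡ 1` on every configuration with `A(∂p) = 0` near `p′` (`cplaq_bavg_expUnit_eq_one_of_flat`).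
NOT HERE: non-abelian groups (there (47)–(50) carry the printed `O((L²α₀)²)`: tree `B7Prop1Explicit.prop1_explicit`,
`B7Eq50Linear.prop1_linear`); the torus; anything of NE7.
-/

noncomputable section

open scoped BigOperators
open NormedSpace Finset

namespace Summit.QuantumFields.BalabanUV.T4Continuum.NE7BlockAverageContourGaugeAbelian

open Literature.MathematicalPhysics.QuantumFieldTheory.Balaban1983to89
open Literature.MathematicalPhysics.QuantumFieldTheory.Balaban1983to89.B7Prop1Explicit
open Summit.QuantumFields.BalabanUV.T4Continuum.AbelianBlockAverage
open Summit.QuantumFields.BalabanUV.T4Continuum.NE7BlockAverageContourGaugeZd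

variable {d : ℕ} {𝔸 : Type*} [NormedCommRing 𝔸] [NormedAlgebra ℂ 𝔸] [CompleteSpace 𝔸]

/-! ## §1 `exp` into the units of a commutative algebra -/

/-- `exp(X + Y) = exp X · exp Y` as units (commutative algebra). [folklore] -/
theorem expUnit_add (X Y : 𝔸) : expUnit (X + Y) = expUnit X * expUnit Y := by
  apply Units.ext
  letI : NormedAlgebra ℚ 𝔸 := NormedAlgebra.restrictScalars ℚ ℂ 𝔸
  simp only [Units.val_mul, val_expUnit]
  exact exp_add_of_commute (Commute.all _ _)

/-- `exp(−X) = (exp X)⁻¹` as units. [folklore] -/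
theorem expUnit_neg (X : 𝔸) : expUnit (-X) = (expUnit X)⁻¹ := (val_inv_expUnit X).symm

/-- `exp(X − Y) = exp X · (exp Y)⁻¹` as units (commutative algebra). [folklore] -/
theorem expUnit_sub (X Y : 𝔸) : expUnit (X - Y) = expUnit X * (expUnit Y)⁻¹ := by
  rw [sub_eq_add_neg, expUnit_add, expUnit_neg]

/-- The fine plaquette variable of `V = exp ∘ A` is `exp(A(∂p))` (tree `hol_expUnit` on the plaquette word; `cplaq 1 V =
V(∂p)` by `cplaq_one`). [folklore] -/
theorem hol_expUnit_plaqWord (A : Site d → Fin d → 𝔸) (x : Site d) (μ ν : Fin d) :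
    hol (fun y κ => expUnit (A y κ)) x (plaqWord μ ν) = expUnit (asum A x (plaqWord μ ν)) :=
  hol_expUnit A x (plaqWord μ ν)

/-! ## §2 The abelian average (42): straight average, gauge-transformed by `exp` of the tree potential -/

variable (L : ℕ)

/-- **THE NON-LINEAR AVERAGE (42) OF AN ABELIAN CONFIGURATION IS A COARSE GAUGE TRANSFORM OF THE STRAIGHT AVERAGE**:
`V̄_c = exp(Φ(c₋)) · exp(Σ_{x∈B(c₋)} L^{−d}A([x,x(c)])) · exp(Φ(c₊))⁻¹` with `Φ = treePot L A` the tree potential, for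
`V = exp ∘ A` inside the ball of the logarithm (tree `bavg_expUnit` + `Tside_eq`). [cite: Balaban1985Averaging, (42) p.23, (45) p.24] -/
theorem bavg_expUnit_eq_gauge (hL : 1 ≤ L) (A : Site d → Fin d → 𝔸) (q : Site d) (κ : Fin d)
    (hsmall : ∀ r : Fin d → Fin L, ‖asum A q (gammaWord L κ (boxVec L r) ++ seg κ (-(L : ℤ)))‖ < Real.log 2) :
    bavg L (fun y μ => expUnit (A y μ)) q κ
      = expUnit (treePot L A q) * expUnit (Qstraight L A q κ) * (expUnit (treePot L A (q + (L : ℤ) • e κ)))⁻¹ := by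
  rw [bavg_expUnit L hL A q κ hsmall, Tside_eq, ← expUnit_add, ← expUnit_sub]
  congr 1
  abel

/-- **THE COARSE PLAQUETTE OF (42), ABELIAN CASE, EXACTLY**: `V̄(∂p′) = exp(cplaqLin L (Tside L A) p′)` — the product of the
four averaged bond variables around `p′` is `exp` of the linearised coarse plaquette of `Tside` (no second-order terms: the
algebra is commutative). [cite: Balaban1985Averaging, (44) p.24, (47) p.25] -/
theorem cplaq_bavg_expUnit (hL : 1 ≤ L) (A : Site d → Fin d → 𝔸) (z : Site d) (μ ν : Fin d)
    (hsmall : ∀ (q : Site d) (κ : Fin d) (r : Fin d → Fin L),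
      ‖asum A q (gammaWord L κ (boxVec L r) ++ seg κ (-(L : ℤ)))‖ < Real.log 2) :
    cplaq L (bavg L (fun y κ => expUnit (A y κ))) z μ ν = expUnit (cplaqLin L (Tside L A) z μ ν) := by
  simp only [cplaq, bavg_expUnit L hL A _ _ (hsmall _ _), cplaqLin, ← expUnit_add, ← expUnit_sub]

/-- **(47)–(50) WITHOUT ERROR TERM**: `V̄(∂p′) = exp(Σ_{x∈B(y₀)} L^{−d} A(∂(p′)_x))` — the coarse plaquette variable of the
averaged abelian field is `exp` of the block mean of the `L × L` Wilson loop sums; the tree contours of (42) do not enter.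
[cite: Balaban1985Averaging, (48)–(50) p.25] -/
theorem cplaq_bavg_expUnit_eq_blockMean (hL : 1 ≤ L) (A : Site d → Fin d → 𝔸) (z : Site d) (μ ν : Fin d)
    (hsmall : ∀ (q : Site d) (κ : Fin d) (r : Fin d → Fin L),
      ‖asum A q (gammaWord L κ (boxVec L r) ++ seg κ (-(L : ℤ)))‖ < Real.log 2) :
    cplaq L (bavg L (fun y κ => expUnit (A y κ))) z μ ν
      = expUnit (∑ r : Fin d → Fin L, (((L : ℝ) ^ d)⁻¹) • asum A (z + boxVec L r) (rectWord L L μ ν)) := by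
  rw [cplaq_bavg_expUnit L hL A z μ ν hsmall, cplaqLin_Tside]

/-- … `= exp(Σ_{x∈B(y₀)} L^{−d} Σ_{p⊂(p′)_x} A(∂p))`: the GEOMETRIC BLOCK MEAN of the products of the `L²` fine plaquette
variables `V(∂p) = exp(A(∂p))` (abelian Stokes, tree `stokes`). [cite: Balaban1985Averaging, (48) p.25] -/
theorem cplaq_bavg_expUnit_eq_stokes (hL : 1 ≤ L) (A : Site d → Fin d → 𝔸) (z : Site d) (μ ν : Fin d)
    (hsmall : ∀ (q : Site d) (κ : Fin d) (r : Fin d → Fin L),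
      ‖asum A q (gammaWord L κ (boxVec L r) ++ seg κ (-(L : ℤ)))‖ < Real.log 2) :
    cplaq L (bavg L (fun y κ => expUnit (A y κ))) z μ ν
      = expUnit (∑ r : Fin d → Fin L, (((L : ℝ) ^ d)⁻¹) •
          ∑ i ∈ Finset.range L, ∑ j ∈ Finset.range L,
            asum A (z + boxVec L r + (i : ℤ) • e μ + (j : ℤ) • e ν) (plaqWord μ ν)) := by
  rw [cplaq_bavg_expUnit L hL A z μ ν hsmall, cplaqLin_Tside_eq_blockMean]

/-- The abelian coarse plaquette of (42) equals that of the straight average `exp ∘ Qstraight`: the two averaged fields are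
gauge equivalent on the `L`-lattice. [folklore] -/
theorem cplaq_bavg_expUnit_eq_cplaq_straight (hL : 1 ≤ L) (A : Site d → Fin d → 𝔸) (z : Site d) (μ ν : Fin d)
    (hsmall : ∀ (q : Site d) (κ : Fin d) (r : Fin d → Fin L),
      ‖asum A q (gammaWord L κ (boxVec L r) ++ seg κ (-(L : ℤ)))‖ < Real.log 2) :
    cplaq L (bavg L (fun y κ => expUnit (A y κ))) z μ ν
      = cplaq L (fun q κ => expUnit (Qstraight L A q κ)) z μ ν := by
  rw [cplaq_bavg_expUnit L hL A z μ ν hsmall, cplaqLin_Tside_eq_Qstraight]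
  simp only [cplaq, cplaqLin, ← expUnit_add, ← expUnit_sub]

/-- FLAT DATA: if every fine plaquette sum `A(∂p)` vanishes on the `L × L` squares based in the block of `z`, then
`V̄(∂p′) = 1` exactly — whatever the (pure-gauge) bond variables and whatever the tree contours carry. [folklore] -/
theorem cplaq_bavg_expUnit_eq_one_of_flat (hL : 1 ≤ L) (A : Site d → Fin d → 𝔸) (z : Site d) (μ ν : Fin d)
    (hsmall : ∀ (q : Site d) (κ : Fin d) (r : Fin d → Fin L),
      ‖asum A q (gammaWord L κ (boxVec L r) ++ seg κ (-(L : ℤ)))‖ < Real.log 2)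
    (hflat : ∀ (r : Fin d → Fin L) (i j : ℕ), i < L → j < L →
      asum A (z + boxVec L r + (i : ℤ) • e μ + (j : ℤ) • e ν) (plaqWord μ ν) = 0) :
    cplaq L (bavg L (fun y κ => expUnit (A y κ))) z μ ν = 1 := by
  rw [cplaq_bavg_expUnit_eq_stokes L hL A z μ ν hsmall]
  have h0 : ∑ r : Fin d → Fin L, (((L : ℝ) ^ d)⁻¹) •
      ∑ i ∈ Finset.range L, ∑ j ∈ Finset.range L,
        asum A (z + boxVec L r + (i : ℤ) • e μ + (j : ℤ) • e ν) (plaqWord μ ν) = 0 := by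
    refine Finset.sum_eq_zero fun r _ => ?_
    rw [Finset.sum_eq_zero fun i hi => Finset.sum_eq_zero fun j hj =>
      hflat r i j (Finset.mem_range.mp hi) (Finset.mem_range.mp hj), smul_zero]
  rw [h0]
  apply Units.ext
  simp

end Summit.QuantumFields.BalabanUV.T4Continuum.NE7BlockAverageContourGaugeAbelian

end
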